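import Summits.ResolutionOfSingularities.ResolutionOfSingularities.Theorems.MarkedTransferCampaignW46ThreefoldsPlumbing
import HarnessLib

/-!
# [OURS · L1 W4.6 rung (ii)] THREEFOLD HYPERSURFACES — the COMPONENT-WISE reduction: ∇-centred termination of the typed
# Th. 16.6 procedure (`TerminatesNabla`, design finding D1) from the one-step shapes plus structural hypotheses, counting
# the irreducible components of the terminal plat through strict transforms (companion of
# `Theorems/MarkedTransferCampaignW46Threefolds.lean` v2 and `…ThreefoldsReduction.lean`)

Cell res-hironaka, LADDER-RESOLUTION rung L (D-0089), slot W4.6, rung (ii); seat res-L1-s46-pv-3. Host route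
MarkedTransfer, `--supports stmt-ResolutionOfSingularities-16156` (`HypersurfaceOrderReductionDimLeThree`).

HONEST FRAMING. Every theorem below is PURE LOGIC over the OURS campaign definitions (`CampaignW46.RunNabla`,
`StepNabla`, `IsNablaComponent`, `DecreaseAlongSteps`, `EqualityAlongSteps`, `StopsMonotone`, `NablaTop`, `OffCentreLocal`,
`TerminatesNabla`, `regimeII`, …) together with: the tree's order theory of the typed `Inv`-strings
(`Hironaka2017.InvStringOrder`), the tree's topology of irreducible components and strict transforms
(`Resolution.componentsIn`, `strictTransformSet`, `ncard_componentsIn_of_eq_biUnion_strictTransformSet` — de Jong 1996,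
4.27, kernel-proved there), the tree's `IsBlowup.isIso_morphismRestrict` (a blow-up is an isomorphism off its centre,
GW I 13.91 (3), kernel-proved), and Mathlib's Jacobson / Noetherian scheme facts for schemes of finite type over a
field. NOTHING here is a statement of H. Hironaka's manuscript *Resolution of singularities in positive characteristics*
(2017-03-23, [Hironaka2017]) and nothing here asserts that any statement of it holds: the typed candidate occurs only
as the HYPOTHESIS `h : S16Proof.Thm16_6 …` of the `_of_thm16_6` variants (it supplies the Eq. (127)- and Eq. (128)-shapes
through the anchors). FACT-LIST §A/§B premises: none needed. AI review is weaker than expert review. No `sorry`; axioms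
standard.

## What is proved (OURS)

* `terminatesNabla_of_decrease` (general regime `Rg`): `DecreaseAlongSteps → EqualityAlongSteps → StopsMonotone →
  NablaTop → OffCentreLocal → TerminatesNabla` (all at `N Rd Rg`). THE MEASURE IS OURS: (padded top `Inv`-string at the
  `NablaTop` witness, number of irreducible components of `∇(E_k)`), lexicographically. Along a ∇-step the top string
  never increases (`Step.padFin_le_of_step`: off the centre strings are unchanged; over the centre off `D′` Eq. (127);
  on `D′` Eq. (128) at length `m` with `m′ ≤ m` makes the new string a PREFIX of the top one); if it stalls, the new
  terminal plat is exactly the strict transform `∇′` of the old one (`Step.nabla_eq_strictTransformSet_of_padFin_eq`: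
  pointwise on closed points, then Jacobson density of closed points in locally closed sets), which has one irreducible
  component fewer (`Step.ncard_componentsIn_lt`: the centre is a component of the Noetherian closed set `∇(E)`, the
  blow-up is an isomorphism off it, de Jong's count). Well-foundedness of the padded strings under the bound
  `m_k ≤ m_0` and of `ℕ` ends every ∇-centred run (`no_stalling_descent`). The manuscript prints no measure for this
  step (§16.3 p.87 l.19–22; GAP-LEDGER R11); this file supplies one under five named hypothesis shapes.
* `terminatesNablaII_of_decrease` = the same at `regimeII` — RUNG (ii) in the registered ∇-centred shape:
  `DecreaseII ∧ EqualityII ∧ StopsMonotoneII ∧ NablaTopII ∧ OffCentreLocalII → TerminatesNablaII`;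
  `terminatesNablaII_of_thm16_6` = the same with `DecreaseII`/`EqualityII` supplied by the typed candidate `Thm16_6`.
* Anchor `equalityAlongSteps_of_thm16_6` (part (3) of the candidate gives `EqualityAlongSteps` in every regime);
  plumbing module `…ThreefoldsPlumbing` (`IsNablaComponent.mem_componentsIn`,
  `strictTransformSet_eq_biUnion_componentsIn`, `invStr_eq_take`, `not_lexLT_take`, …); the Noetherian / Jacobson
  instances of the ambient are Mathlib's (`LocallyOfFiniteType.isLocallyNoetherian` / `.jacobsonSpace`), inlined.

## References

* `Theorems/MarkedTransferCampaignW46Threefolds.lean` v2 (statement module), `…ThreefoldsReduction.lean` (whole-∇ form);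
  shared module + anchors (res-L1-type-o1; D1 section after res-L1-s47-dis-1).
* Tree: `Literature.AlgebraicGeometry.Resolution.AlterationsNormalFormBlowupParts` (componentsIn, strict transforms)
  [DeJong1996, 4.27]; `Resolution.Blowups` (`IsBlowup.isIso_morphismRestrict`) [GortzWedhorn2020, Prop. 13.91 (3)];
  `Hironaka2017.InvStringOrder` [BaaderNipkow1998, §2.4]; Mathlib `JacobsonSpace`, Stacks 01TB.
* H. Hironaka, ms. 2017-03-23: Th. 16.6 p.84 l.4–32; §16.3 p.87 l.10–28 — scope only, under adjudication, not cited as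
  fact. [Hironaka2017]
-/

noncomputable section

set_option linter.dupNamespace false -- mandated namespace of this single-conjunct summit

open CategoryTheory AlgebraicGeometry TopologicalSpace

namespace Summit.ResolutionOfSingularities.ResolutionOfSingularities.Theorems

namespace CampaignW46

open Literature.AlgebraicGeometry.Resolution
open Literature.AlgebraicGeometry.Hironaka2017.S02Preliminaries
open Literature.AlgebraicGeometry.Hironaka2017.Datum
open Literature.AlgebraicGeometry.Hironaka2017.S15ARSchemes
open Literature.AlgebraicGeometry.Hironaka2017.S16Proof
open Literature.AlgebraicGeometry.Hironaka2017.InvStringOrder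

universe u

variable {n : ℕ} {p : ℕ} [Fact p.Prime] {K : Type u} [Field K] [CharP K p]


/-! ## One ∇-step: the top string does not increase, and if it does not drop the terminal plat loses a component -/

section OneStep

variable {N : Notions.{u} n} {Rd : Reading p K N} {Rg : Regime p K}
variable {A A' : AmbientDatum p K} {E : IdealExponent A.Z} {R : Resume N A E}

/-- POINTWISE COMPARISON after an admitted step from a state in the regime (pure logic over the five shapes). Fix a closed
`η ∈ Z` realising (T1)/(T2) of `NablaTop` for `R` and a bound `M ≥ m`. Then for every closed `ξ′` of `Z′` and every
résumé `R′` of the transform read by `Rd`: (a) the padded encoding of the string of `R′` at `ξ′` is `≤` that of the top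
string `invStr R η`; (b) if they are EQUAL then `ξ′` lies in the strict transform `∇′` of `∇(E)` along `D`; (c) if
`π ξ′ ∈ ∇(E) ∖ D` then they are equal. Cases: `π ξ′ ∉ D` (strings unchanged, `OffCentreLocal`; (T1)/(T2) downstairs at
the closed point `π ξ′`); `π ξ′ ∈ D`, `ξ′ ∉ D′` (Eq. (127): strictly smaller); `ξ′ ∈ D′` (Eq. (128) at length `m` and
`m′ ≤ m`: the new string is a prefix of the top string). [folklore] -/
theorem Step.padFin_le_of_step (hD : DecreaseAlongSteps N Rd Rg) (hEq : EqualityAlongSteps N Rd Rg)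
    (hM : StopsMonotone N Rd Rg) (hL : OffCentreLocal N Rd Rg) (hRg : Rg A E) (hRd : Rd A E R) (s : Step R A')
    {η : A.Z}
    (hT1 : ∀ ξ : A.Z, ξ ∈ Literature.AlgebraicGeometry.Hironaka2017.S02Preliminaries.closedPoints A.Z →
      ξ ∈ (R.nabla : Set A.Z) → R.invStr ξ = R.invStr η)
    (hT2 : ∀ ξ : A.Z, ξ ∈ Literature.AlgebraicGeometry.Hironaka2017.S02Preliminaries.closedPoints A.Z →
      ξ ∉ (R.nabla : Set A.Z) → InvString.LexLT (R.invStr ξ) (R.invStr η))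
    {M : ℕ} (hMm : R.m ≤ M)
    {E' : IdealExponent A'.Z} (hE' : E' = s.E') (R' : Resume N A' E') (hRd' : Rd A' E' R') {ξ' : A'.Z}
    (hξ' : ξ' ∈ Literature.AlgebraicGeometry.Hironaka2017.S02Preliminaries.closedPoints A'.Z) :
    padFin M (R'.invStr ξ') ≤ padFin M (R.invStr η) ∧
      (padFin M (R'.invStr ξ') = padFin M (R.invStr η) →
        ξ' ∈ strictTransformSet s.π (s.D : Set A.Z) (R.nabla : Set A.Z)) ∧
      (s.π ξ' ∈ (R.nabla : Set A.Z) → s.π ξ' ∉ (s.D : Set A.Z) →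
        padFin M (R'.invStr ξ') = padFin M (R.invStr η)) := by
  subst hE'
  have hζ := s.apply_mem_closedPoints hξ'
  have hM' : R'.m ≤ M := (hM A E R hRg hRd A' s R' hRd').trans hMm
  have hlenη : (R.invStr η).length ≤ M := by rw [Resume.length_invStr]; exact hMm
  have hlenξ' : (R'.invStr ξ').length ≤ M := by rw [Resume.length_invStr]; exact hM'
  by_cases hDζ : s.π ξ' ∈ (s.D : Set A.Z)
  · -- over the centre
    have hin : s.π ξ' ∈ (R.nabla : Set A.Z) := s.centre.subset_nabla hDζ
    have eζ : R.invStr (s.π ξ') = R.invStr η := hT1 _ hζ hin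
    by_cases hDP : ξ' ∈ R.mti.DPrime s.π s.D
    · -- on D′ ⊆ ∇′ : Eq. (128) at length m, and m′ ≤ m
      have h128 : Eq128 R.mti (s.π ξ') R'.mti ξ' := (hEq A E R hRg hRd A' s R' hRd') ξ' hξ' hDP.1
      have hm' : R'.m ≤ R.m := hM A E R hRg hRd A' s R' hRd'
      have htake : R'.invStr ξ' = (R.invStr η).take R'.m := by
        rw [← eζ]
        change R'.mti.invStr R'.m ξ' = (R.mti.invStr R.m (s.π ξ')).take R'.m
        rw [invStr_eq_take R'.mti hm' ξ']
        exact congrArg (fun L => List.take R'.m L) h128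
      have hle : padFin M (R'.invStr ξ') ≤ padFin M (R.invStr η) := by
        rw [htake]
        by_contra hlt
        rw [not_le] at hlt
        have hlen2 : ((R.invStr η).take R'.m).length ≤ M :=
          (List.length_take_le' _ _).trans hlenη
        exact not_lexLT_take (R.invStr η) R'.m ((lexLT_iff_padFin_lt hlenη hlen2).mpr hlt)
      refine ⟨hle, fun _ => hDP.1, fun _ hnot => absurd hDζ hnot⟩
    · -- over the centre, off D′ : Eq. (127)
      have h127 : Eq127 R.mti (s.π ξ') R'.mti ξ' := (hD A E R hRg hRd A' s R' hRd').1 ξ' hξ' hDζ hDP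
      change InvString.LexLT (R'.invStr ξ') (R.invStr (s.π ξ')) at h127
      rw [eζ] at h127
      have hlt : padFin M (R'.invStr ξ') < padFin M (R.invStr η) := (lexLT_iff_padFin_lt hlenξ' hlenη).mp h127
      exact ⟨hlt.le, fun heq => absurd heq hlt.ne, fun _ hnot => absurd hDζ hnot⟩
  · -- off the centre: strings unchanged
    have e := hL A E R hRg hRd A' s R' hRd' ξ' hξ' hDζ
    by_cases hin : s.π ξ' ∈ (R.nabla : Set A.Z)
    · have eζ : R.invStr (s.π ξ') = R.invStr η := hT1 _ hζ hin
      have heq : padFin M (R'.invStr ξ') = padFin M (R.invStr η) := by rw [e, eζ]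
      refine ⟨heq.le, fun _ => ?_, fun _ _ => heq⟩
      exact strictTransformSet.preimage_diff_subset s.π _ _ ⟨hin, hDζ⟩
    · have hlt' := hT2 _ hζ hin
      rw [← e] at hlt'
      have hlt : padFin M (R'.invStr ξ') < padFin M (R.invStr η) := (lexLT_iff_padFin_lt hlenξ' hlenη).mp hlt'
      exact ⟨hlt.le, fun heq => absurd heq hlt.ne, fun hin' _ => absurd hin' hin⟩

/-- Transport of `StopsMonotone` along the bookkeeping equation `E_{k+1} = E_k′` of a run. [folklore] -/
theorem Step.stops_le (hM : StopsMonotone N Rd Rg) (hRg : Rg A E) (hRd : Rd A E R) (s : Step R A')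
    {E' : IdealExponent A'.Z} (hE' : E' = s.E') (R' : Resume N A' E') (hRd' : Rd A' E' R') : R'.m ≤ R.m := by
  subst hE'
  exact hM A E R hRg hRd A' s R' hRd'

/-- IF THE TOP STRING DOES NOT DROP, THE NEW TERMINAL PLAT IS THE STRICT TRANSFORM OF THE OLD ONE. With closed points
`η`, `η′` realising `NablaTop` for `R` and `R′`: if the padded top strings agree, then `∇(E′) = ∇′` (the tree's
`strictTransformSet π D ∇ = closure (π⁻¹(∇ ∖ D))`) AS SETS. On closed points this is the pointwise comparison
(`Step.padFin_le_of_step`: the top stratum upstairs lies in `∇′`, and `π⁻¹(∇ ∖ D)` lies in the top stratum); the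
passage from closed points to the closed sets is the Jacobson property of `Z′` (closed points are dense in every
locally closed subset; `∇(E′)` is closed by the résumé's Def. 15.12 hypothesis field). [folklore] -/
theorem Step.nabla_eq_strictTransformSet_of_padFin_eq (hD : DecreaseAlongSteps N Rd Rg)
    (hEq : EqualityAlongSteps N Rd Rg) (hM : StopsMonotone N Rd Rg) (hL : OffCentreLocal N Rd Rg) (hRg : Rg A E)
    (hRd : Rd A E R) (s : Step R A') {η : A.Z}
    (hT1 : ∀ ξ : A.Z, ξ ∈ Literature.AlgebraicGeometry.Hironaka2017.S02Preliminaries.closedPoints A.Z →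
      ξ ∈ (R.nabla : Set A.Z) → R.invStr ξ = R.invStr η)
    (hT2 : ∀ ξ : A.Z, ξ ∈ Literature.AlgebraicGeometry.Hironaka2017.S02Preliminaries.closedPoints A.Z →
      ξ ∉ (R.nabla : Set A.Z) → InvString.LexLT (R.invStr ξ) (R.invStr η))
    {M : ℕ} (hMm : R.m ≤ M)
    {E' : IdealExponent A'.Z} (hE' : E' = s.E') (R' : Resume N A' E') (hRd' : Rd A' E' R') {η' : A'.Z}
    (hT1' : ∀ ξ' : A'.Z, ξ' ∈ Literature.AlgebraicGeometry.Hironaka2017.S02Preliminaries.closedPoints A'.Z →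
      ξ' ∈ (R'.nabla : Set A'.Z) → R'.invStr ξ' = R'.invStr η')
    (hT2' : ∀ ξ' : A'.Z, ξ' ∈ Literature.AlgebraicGeometry.Hironaka2017.S02Preliminaries.closedPoints A'.Z →
      ξ' ∉ (R'.nabla : Set A'.Z) → InvString.LexLT (R'.invStr ξ') (R'.invStr η'))
    (heq : padFin M (R'.invStr η') = padFin M (R.invStr η)) :
    (R'.nabla : Set A'.Z) = strictTransformSet s.π (s.D : Set A.Z) (R.nabla : Set A.Z) := by
  subst hE'
  haveI := A'.smooth
  haveI : JacobsonSpace A'.Z := LocallyOfFiniteType.jacobsonSpace A'.hom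
  have hM' : R'.m ≤ M := (hM A E R hRg hRd A' s R' hRd').trans hMm
  have hP := fun (ξ' : A'.Z)
      (hξ' : ξ' ∈ Literature.AlgebraicGeometry.Hironaka2017.S02Preliminaries.closedPoints A'.Z) =>
    Step.padFin_le_of_step hD hEq hM hL hRg hRd s hT1 hT2 hMm rfl R' hRd' hξ'
  -- (i) the closed points of ∇(E′) lie in the strict transform
  have h1 : ∀ ξ' : A'.Z, ξ' ∈ Literature.AlgebraicGeometry.Hironaka2017.S02Preliminaries.closedPoints A'.Z →
      ξ' ∈ (R'.nabla : Set A'.Z) → ξ' ∈ strictTransformSet s.π (s.D : Set A.Z) (R.nabla : Set A.Z) := by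
    intro ξ' hc hn
    refine (hP ξ' hc).2.1 ?_
    rw [hT1' ξ' hc hn]
    exact heq
  -- (ii) the closed points over ∇(E) ∖ D lie in ∇(E′)
  have h2 : ∀ ξ' : A'.Z, ξ' ∈ Literature.AlgebraicGeometry.Hironaka2017.S02Preliminaries.closedPoints A'.Z →
      s.π ξ' ∈ (R.nabla : Set A.Z) → s.π ξ' ∉ (s.D : Set A.Z) → ξ' ∈ (R'.nabla : Set A'.Z) := by
    intro ξ' hc hin hnD
    by_contra hout
    have hlt := hT2' ξ' hc hout
    have heq' := (hP ξ' hc).2.2 hin hnD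
    have hlenξ : (R'.invStr ξ').length ≤ M := by rw [Resume.length_invStr]; exact hM'
    have hlenη' : (R'.invStr η').length ≤ M := by rw [Resume.length_invStr]; exact hM'
    have hlt2 := (lexLT_iff_padFin_lt hlenξ hlenη').mp hlt
    rw [heq', heq] at hlt2
    exact lt_irrefl _ hlt2
  apply Set.Subset.antisymm
  · -- ∇(E′) ⊆ ∇′: Jacobson, ∇(E′) closed
    have hcl : closure ((R'.nabla : Set A'.Z) ∩ _root_.closedPoints A'.Z) = (R'.nabla : Set A'.Z) :=
      closure_inter_closedPoints R'.nabla.isClosed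
    rw [← hcl]
    exact closure_minimal (fun x hx => h1 x hx.2 hx.1) (strictTransformSet.isClosed _ _ _)
  · -- ∇′ ⊆ ∇(E′): it suffices that π⁻¹(∇ ∖ D) ⊆ ∇(E′); test on closed points of a locally closed set
    refine closure_minimal ?_ R'.nabla.isClosed
    intro x hx
    by_contra hxn
    have hdiff : IsLocallyClosed ((R.nabla : Set A.Z) \ (s.D : Set A.Z)) := by
      rw [Set.sdiff_eq]
      exact R.nabla.isClosed.isLocallyClosed.inter s.D.isClosed.isOpen_compl.isLocallyClosed
    have hlc : IsLocallyClosed (s.π ⁻¹' ((R.nabla : Set A.Z) \ (s.D : Set A.Z)) ∩ (R'.nabla : Set A'.Z)ᶜ) :=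
      (hdiff.preimage s.π.continuous).inter R'.nabla.isClosed.isOpen_compl.isLocallyClosed
    obtain ⟨y, ⟨hy1, hy2⟩, hyc⟩ :=
      nonempty_inter_closedPoints (Z := s.π ⁻¹' ((R.nabla : Set A.Z) \ (s.D : Set A.Z)) ∩ (R'.nabla : Set A'.Z)ᶜ)
        ⟨x, ⟨hx, hxn⟩⟩ hlc
    exact hy2 (h2 y hyc hy1.1 hy1.2)

/-- IF THE NEW TERMINAL PLAT IS THE STRICT TRANSFORM, IT HAS ONE COMPONENT FEWER (tree: de Jong 1996, 4.27 —
`Resolution.ncard_componentsIn_of_eq_biUnion_strictTransformSet`): the centre of a ∇-step is an irreducible component of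
the closed Noetherian set `∇(E)`, the blow-up is an isomorphism off the centre (`IsBlowup.isIso_morphismRestrict`), and
`∇′` is the union of the strict transforms of the other components. [folklore] -/
theorem Step.ncard_componentsIn_lt (s : Step R A') (hcomp : IsNablaComponent R s.D) {E' : IdealExponent A'.Z}
    (R' : Resume N A' E')
    (hN : (R'.nabla : Set A'.Z) = strictTransformSet s.π (s.D : Set A.Z) (R.nabla : Set A.Z)) :
    (componentsIn (R'.nabla : Set A'.Z)).ncard < (componentsIn (R.nabla : Set A.Z)).ncard := by
  haveI := A.smooth
  haveI := A.quasiCompact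
  haveI : IsLocallyNoetherian A.Z := LocallyOfFiniteType.isLocallyNoetherian A.hom
  haveI : CompactSpace A.Z := QuasiCompact.compactSpace_of_compactSpace A.hom
  haveI : IsNoetherian A.Z := {}
  have hfin : (componentsIn (R.nabla : Set A.Z)).Finite := componentsIn.finite _
  have hE : (s.D : Set A.Z) ∈ componentsIn (R.nabla : Set A.Z) := hcomp.mem_componentsIn
  haveI : IsIso (s.π ∣_ ⟨(s.D : Set A.Z)ᶜ, (componentsIn.isClosed R.nabla.isClosed hE).isOpen_compl⟩) :=
    s.blowup.isIso_morphismRestrict (by simpa using disjoint_compl_left)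
  have hS' : (R'.nabla : Set A'.Z) =
      ⋃ E₁ ∈ componentsIn (R.nabla : Set A.Z) \ {(s.D : Set A.Z)}, strictTransformSet s.π (s.D : Set A.Z) E₁ := by
    rw [hN, strictTransformSet_eq_biUnion_componentsIn s.π (s.D : Set A.Z) hfin]
  have h := (ncard_componentsIn_of_eq_biUnion_strictTransformSet s.π R.nabla.isClosed hfin hE hS').2
  omega

end OneStep

/-! ## The component-wise reduction: ∇-centred termination -/

section Reduction

/-- Pure order theory: a sequence in a well-founded linear order that never increases, paired with a natural number that
strictly drops whenever the first coordinate stalls, cannot be infinite. [folklore] -/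
theorem no_stalling_descent {W : Type*} [LinearOrder W] [WellFoundedLT W] (e : ℕ → W) (c : ℕ → ℕ)
    (hle : ∀ k, e (k + 1) ≤ e k) (hlt : ∀ k, e (k + 1) = e k → c (k + 1) < c k) : False := by
  obtain ⟨w, ⟨k₀, rfl⟩, hmin⟩ := WellFounded.has_min wellFounded_lt (Set.range e) ⟨e 0, 0, rfl⟩
  have hanti : ∀ j, e (k₀ + j) ≤ e k₀ := by
    intro j
    induction j with
    | zero => exact le_rfl
    | succ j ih => exact (hle (k₀ + j)).trans ih
  have hconst : ∀ j, e (k₀ + j) = e k₀ := fun j =>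
    le_antisymm (hanti j) (not_lt.mp (hmin _ ⟨k₀ + j, rfl⟩))
  have hc : ∀ j, c (k₀ + j) + j ≤ c k₀ := by
    intro j
    induction j with
    | zero => exact le_rfl
    | succ j ih =>
      have h1 : c (k₀ + j + 1) < c (k₀ + j) := hlt (k₀ + j) ((hconst (j + 1)).trans (hconst j).symm)
      have h2 : c (k₀ + (j + 1)) = c (k₀ + j + 1) := rfl
      omega
  have := hc (c k₀ + 1)
  omega

variable {N : Notions.{u} n} {Rd : Reading p K N} {Rg : Regime p K}

/-- **THE COMPONENT-WISE REDUCTION THEOREM (general regime).** If, for states in the regime `Rg` (notion instance `N`,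
reading `Rd`), every admitted step satisfies Eq. (127) off `D′` with `m′ ≤ m` there (`DecreaseAlongSteps`), Eq. (128) on
`∇′` (`EqualityAlongSteps`) and `m′ ≤ m` (`StopsMonotone`), the terminal plat is the top stratum of the `Inv`-string
(`NablaTop`), and strings are unchanged off the centre across renewal (`OffCentreLocal`) — then there is NO infinite
∇-CENTRED run inside `Rg` (`TerminatesNabla`, the registered «hence terminates» shape of design finding D1: centres =
irreducible COMPONENTS of `∇(E_k)`). OUR MEASURE: the pair (padded top string `μ_k`, number of irreducible components of
`∇(E_k)`) — `μ_k` never increases along a ∇-step (`Step.padFin_le_of_step`), and when it stalls the new terminal plat is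
the strict transform of the old one (`Step.nabla_eq_strictTransformSet_of_padFin_eq`, Jacobson) and has one component
fewer (`Step.ncard_componentsIn_lt`, Noetherian ambient + the tree's de Jong 4.27 count); well-foundedness of the
padded strings under the length bound `m_k ≤ m_0` (`InvStringOrder`) ends the run (`no_stalling_descent`). Pure logic
over the five explicit hypothesis shapes; nothing of the manuscript is used or asserted. [folklore] -/
theorem terminatesNabla_of_decrease (hD : DecreaseAlongSteps N Rd Rg) (hEq : EqualityAlongSteps N Rd Rg)
    (hM : StopsMonotone N Rd Rg) (hT : NablaTop N Rd Rg) (hL : OffCentreLocal N Rd Rg) :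
    TerminatesNabla N Rd Rg := by
  intro r hRg
  choose η _hηn hηc hT1 hT2 using fun k => hT (r.A k) (r.E k) (r.R k) (hRg k) (r.reads k)
  have hmstep : ∀ k, (r.R (k + 1)).m ≤ (r.R k).m := fun k =>
    Step.stops_le hM (hRg k) (r.reads k) (r.step k).toStep (r.E_succ k) (r.R (k + 1)) (r.reads (k + 1))
  have hm : ∀ k, (r.R k).m ≤ (r.R 0).m := by
    intro k
    induction k with
    | zero => exact le_rfl
    | succ k ih => exact (hmstep k).trans ih
  have hstep : ∀ k,
      padFin (r.R 0).m ((r.R (k + 1)).invStr (η (k + 1))) ≤ padFin (r.R 0).m ((r.R k).invStr (η k)) ∧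
        (padFin (r.R 0).m ((r.R (k + 1)).invStr (η (k + 1))) = padFin (r.R 0).m ((r.R k).invStr (η k)) →
          (componentsIn ((r.R (k + 1)).nabla : Set (r.A (k + 1)).Z)).ncard <
            (componentsIn ((r.R k).nabla : Set (r.A k).Z)).ncard) := by
    intro k
    refine ⟨(Step.padFin_le_of_step hD hEq hM hL (hRg k) (r.reads k) (r.step k).toStep (hT1 k) (hT2 k) (hm k)
      (r.E_succ k) (r.R (k + 1)) (r.reads (k + 1)) (hηc (k + 1))).1, fun heq => ?_⟩
    have hN := Step.nabla_eq_strictTransformSet_of_padFin_eq hD hEq hM hL (hRg k) (r.reads k) (r.step k).toStep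
      (hT1 k) (hT2 k) (hm k) (r.E_succ k) (r.R (k + 1)) (r.reads (k + 1)) (hT1 (k + 1)) (hT2 (k + 1)) heq
    exact Step.ncard_componentsIn_lt (r.step k).toStep (r.step k).component (r.R (k + 1)) hN
  exact no_stalling_descent (fun k => padFin (r.R 0).m ((r.R k).invStr (η k)))
    (fun k => (componentsIn ((r.R k).nabla : Set (r.A k).Z)).ncard) (fun k => (hstep k).1) fun k => (hstep k).2

/-- The component-wise reduction with the two one-step shapes supplied by the typed candidate: `S16Proof.Thm16_6 n
(primeR N Rd) _` (any part-(4) parameter; a HYPOTHESIS, through the anchors `decreaseAlongSteps_of_thm16_6` and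
`equalityAlongSteps_of_thm16_6`) together with `StopsMonotone`/`NablaTop`/`OffCentreLocal` in the regime gives
∇-centred termination in the regime. Nothing of the manuscript is asserted. [folklore] -/
theorem terminatesNabla_of_thm16_6 [PerfectField K]
    {pPosiEmptyAt : ∀ {W : Scheme.{u}}, IdealExponent W → W → Prop}
    (h : Thm16_6 (p := p) (K := K) n (primeR N Rd) pPosiEmptyAt) (hM : StopsMonotone N Rd Rg)
    (hT : NablaTop N Rd Rg) (hL : OffCentreLocal N Rd Rg) : TerminatesNabla N Rd Rg :=
  terminatesNabla_of_decrease (decreaseAlongSteps_of_thm16_6 N Rd h Rg) (equalityAlongSteps_of_thm16_6 N Rd h Rg)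
    hM hT hL

/-- Pure logic: enlarging the regime strengthens `EqualityAlongSteps`. [folklore] -/
theorem equalityAlongSteps_antitone {Rg₁ Rg₂ : Regime p K} (hle : ∀ A E, Rg₁ A E → Rg₂ A E)
    (h : EqualityAlongSteps N Rd Rg₂) : EqualityAlongSteps N Rd Rg₁ :=
  fun A E R h₁ hRd A' s R' hR' => h A E R (hle A E h₁) hRd A' s R' hR'

/-- Pure logic: enlarging the regime strengthens `StopsMonotone`. [folklore] -/
theorem stopsMonotone_antitone {Rg₁ Rg₂ : Regime p K} (hle : ∀ A E, Rg₁ A E → Rg₂ A E)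
    (h : StopsMonotone N Rd Rg₂) : StopsMonotone N Rd Rg₁ :=
  fun A E R h₁ hRd A' s R' hR' => h A E R (hle A E h₁) hRd A' s R' hR'

end Reduction

/-! ## Rung (ii), ∇-centred form: threefold hypersurfaces -/

section RungII

variable (N : Notions.{u} n) (Rd : Reading p K N)

/-- **RUNG (ii), ∇-CENTRED FORM, PROVED AS A REDUCTION.** For the NAMED notion instance `N` and reading `Rd`: the
one-step rungs `DecreaseII` (Eq. (127) off `D′`, `m′ ≤ m`) and `EqualityII` (Eq. (128) on `∇′`) together with
`StopsMonotoneII`, `NablaTopII`, `OffCentreLocalII` imply `TerminatesNablaII` — the typed Th. 16.6 procedure whose centres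
are the irreducible components of the terminal plats admits no infinite run all of whose stages are hypersurface
exponents in an ambient of Krull dimension `≤ 3` (the regime where MarkedTransfer `HypersurfaceOrderReductionDimLeThree`,
stmt-16156, applies; its conclusion is NOT used). [folklore] -/
theorem terminatesNablaII_of_decrease (hD : DecreaseII N Rd) (hEq : EqualityII N Rd) (hM : StopsMonotoneII N Rd)
    (hT : NablaTopII N Rd) (hL : OffCentreLocalII N Rd) : TerminatesNablaII N Rd :=
  terminatesNabla_of_decrease hD hEq hM hT hL

/-- Rung (ii), ∇-centred form, with both one-step shapes taken from the typed candidate `S16Proof.Thm16_6` (reading R,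
any part-(4) parameter) AS A HYPOTHESIS: `Thm16_6 → StopsMonotoneII → NablaTopII → OffCentreLocalII → TerminatesNablaII`.
[folklore] -/
theorem terminatesNablaII_of_thm16_6 [PerfectField K]
    {pPosiEmptyAt : ∀ {W : Scheme.{u}}, IdealExponent W → W → Prop}
    (h : Thm16_6 (p := p) (K := K) n (primeR N Rd) pPosiEmptyAt) (hM : StopsMonotoneII N Rd)
    (hT : NablaTopII N Rd) (hL : OffCentreLocalII N Rd) : TerminatesNablaII N Rd :=
  terminatesNabla_of_thm16_6 h hM hT hL

end RungII

end CampaignW46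

end Summit.ResolutionOfSingularities.ResolutionOfSingularities.Theorems

end
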